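import Literature.NumberTheory.DiophantineGeometry.FunctionFieldNonspecialDivisors
import Literature.NumberTheory.DiophantineGeometry.FunctionFieldEllRationalPlaceOfGenusPos
import HarnessLib

/-!
# Non-special sums of DISTINCT rational places through a PRESCRIBED place:
# `ℓ(Q + P₁ + ⋯ + P_{g−1}) = 1` with `Q, P₁, …, P_{g−1}` pairwise distinct, `Pⱼ` outside any finite set
# (Milne, *Jacobian Varieties*, §5 Lemma 5.2 (b), pointed form)

Topic `Literature/NumberTheory/DiophantineGeometry`, namespace
`Literature.NumberTheory.DiophantineGeometry.AlgFunctionField`.  THEOREMS ONLY (no definition, no named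
fact, no instance, sorry-free).

★ `FunctionFieldNonspecialDivisors` (`exists_ell_sum_single_eq_one`) proves Milne's Lemma 5.2 (b) in the
form «some `P₁, …, P_g ∈ S` with `ℓ(Σ Pᵢ) = 1`».  The local study of the Abel–Jacobi map `f^Q : C → J` at a
point `Q` (Milne Prop. 2.3 through Weil's chart `W = {ℓ = 1} ⊆ C^{(g)}`, where the quotient `Cᵍ → C^{(g)}`
is étale only OFF THE BIG DIAGONAL) needs the POINTED and DISTINCT form: the first summand is the given
`Q`, the other `g − 1` summands are pairwise distinct, distinct from `Q`, and avoid a prescribed finite set.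
The printed induction (Lemma 5.2 (a): at each step all but finitely many rational places lower
`h¹ = ℓ(W − D)` by one) gives this for free as soon as there are enough rational places:

* `ell_canonical_sub_single` — `ℓ(W − Q) = g − 1` for a rational `Q` when `g ≥ 1` (Riemann–Roch + ★
  `ell_single_eq_one_of_one_le_genus`);
* **`exists_injective_ell_canonical_sub_eq`** — the induction of ★ `exists_ell_canonical_sub_eq` with a
  prescribed base divisor `D₀` (`ℓ(W − D₀) = g − deg D₀`), INJECTIVE choices in `S` and an avoidance set `T`
  (`#S ≥ 2g + #T`);
* **`exists_injective_ell_single_add_sum_eq_one`** — for a rational place `Q`, `g ≥ 1`, finite `T` and a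
  set `S` of rational places with `#S ≥ 2g + #T + 1`: pairwise distinct `P₁, …, P_{g−1} ∈ S ∖ (T ∪ {Q})`
  with `ℓ(Q + Σ Pⱼ) = 1`.

Everything is proved; no named facts (D-0026).  Cell `hodgecm-mathlib` (D-0151), count-neutral capital
(input F2a of the tangent clause of Milne JV Prop. 2.3, census
`A-provers/A-p12/g11/CENSUS-MilneProp23-TangentClause.A-p12g11.md`).  HC_CM is proved only modulo the 7
printed citations until rung 0 closes; this file discharges none of them.

## References

* J. S. Milne, *Jacobian Varieties*, in: Arithmetic Geometry (Cornell–Silverman, eds.), Springer 1986,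
  §5 Lemma 5.2 (p. 251 of the volume), §2 Prop. 2.3. [Milne1986JacobianVarieties]
* H. Stichtenoth, *Algebraic Function Fields and Codes*, 2nd ed. (2009), Lemma 1.4.8, Thm. 1.5.15,
  Prop. 1.6.3. [Stichtenoth2009]
-/

set_option autoImplicit false

noncomputable section

namespace Literature.NumberTheory.DiophantineGeometry.AlgFunctionField

universe u v

variable {K : Type u} {F : Type v} [Field K] [Field F] [Algebra K F]

open Finset

/-- **`ℓ(W − Q) = g − 1` for a rational place `Q` and `g ≥ 1`**: Riemann–Roch at `D = Q` with `ℓ(Q) = 1`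
(★ `ell_single_eq_one_of_one_le_genus`). [cite: Milne1986JacobianVarieties, §5 Lemma 5.2 (proof)]
[cite: Stichtenoth2009, Thm. 1.5.15 and Prop. 1.6.3] -/
theorem ell_canonical_sub_single [IsAlgFunctionField K F] [IsIntegrallyClosedIn K F] {W : Divisor K F}
    (hRR : ∀ D : Divisor K F, (ell D : ℤ) = D.degree + 1 - genus K F + ell (W - D))
    {Q : PlaceOver K F} (hQ : Q.degree = 1) (hg : 1 ≤ genus K F) :
    ell (W - Finsupp.single Q 1) + 1 = genus K F := by
  have h1 : ell (Finsupp.single Q (1 : ℤ)) = 1 := ell_single_eq_one_of_one_le_genus hQ hg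
  have h := hRR (Finsupp.single Q 1)
  rw [h1, Divisor.degree_single, hQ] at h
  push_cast at h
  have : (ell (W - Finsupp.single Q 1) : ℤ) + 1 = genus K F := by linarith
  exact_mod_cast this

/-- **Milne's Lemma 5.2 induction, pointed ∕ injective form**: for a canonical divisor `W` satisfying
Riemann–Roch, a base divisor `D₀` of degree `d₀` with `ℓ(W − D₀) = g − d₀`, a finite avoidance set `T` and a
set `S` of rational places with `#S ≥ 2g + #T`: for every `r` with `d₀ + r ≤ g` there are PAIRWISE DISTINCT
`P₁, …, P_r ∈ S ∖ T` with `ℓ(W − D₀ − Σ Pᵢ) = g − d₀ − r`.  At each step a non-zero `f ∈ 𝓛(W − D)` has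
`E = (f) + W − D ≥ 0` of degree `2g − 2 − deg D`; any rational `w ∉ Supp E` lowers `ℓ(W − D)` by exactly one
(★ `ell_add_single_le` and `f ∉ 𝓛(W − D − w)`), and `#S` leaves room to avoid `Supp E`, `T` and the places
already chosen. [cite: Milne1986JacobianVarieties, §5 Lemma 5.2 (a), (b) (proof)]
[cite: Stichtenoth2009, Lemma 1.4.8] -/
theorem exists_injective_ell_canonical_sub_eq [IsAlgFunctionField K F] {W : Divisor K F} (hW : W.IsCanonical)
    (D₀ : Divisor K F) (d₀ : ℕ) (hdeg : D₀.degree = d₀) (hD₀ : ell (W - D₀) + d₀ = genus K F)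
    (T S : Finset (PlaceOver K F)) (hS : ∀ v ∈ S, v.degree = 1) (hcard : 2 * genus K F + T.card ≤ S.card) :
    ∀ r, d₀ + r ≤ genus K F → ∃ v : Fin r → PlaceOver K F, Function.Injective v ∧ (∀ i, v i ∈ S) ∧
      (∀ i, v i ∉ T) ∧ ell (W - D₀ - ∑ i, Finsupp.single (v i) 1) + d₀ + r = genus K F := by
  classical
  intro r
  induction r with
  | zero =>
    intro _
    refine ⟨Fin.elim0, fun i ↦ i.elim0, fun i ↦ i.elim0, fun i ↦ i.elim0, ?_⟩
    simpa using hD₀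
  | succ r ih =>
    intro hr
    obtain ⟨v, hvinj, hvS, hvT, hv⟩ := ih (by omega)
    set D : Divisor K F := D₀ + ∑ i, Finsupp.single (v i) 1 with hD
    have hWD : W - D₀ - ∑ i, Finsupp.single (v i) 1 = W - D := by rw [hD]; abel
    rw [hWD] at hv
    have hdegD : D.degree = d₀ + r := by
      rw [hD, map_add, hdeg, degree_sum_single_of_degree_eq_one v fun i ↦ hS _ (hvS i)]
    -- `ℓ(W − D) = g − d₀ − r ≥ 1`: a non-zero `f ∈ 𝓛(W − D)`
    have hpos : 0 < ell (W - D) := by omega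
    obtain ⟨f, hf, hf0⟩ := exists_mem_ne_zero_of_ell_pos hpos
    -- `E = (f) + W − D ≥ 0`, of degree `2g − 2 − d₀ − r`
    set E : Divisor K F := principalDivisor K f + (W - D) with hE
    have hE0 : 0 ≤ E := (mem_riemannRochSpace_iff_nonneg (W - D) hf0).1 hf
    have hEdeg : E.degree = 2 * (genus K F : ℤ) - 2 - (d₀ + r) := by
      rw [hE, map_add, degree_principalDivisor_eq_zero hf0, map_sub, hW.1, hdegD]; ring
    -- a rational place `w ∈ S` outside `Supp E`, outside `T`, and not yet chosen
    have hbad := card_filter_le_degree hE0 S hS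
    obtain ⟨w, hwS, hwE, hwT, hwv⟩ : ∃ w ∈ S, ¬ 1 ≤ E w ∧ w ∉ T ∧ w ∉ univ.image v := by
      by_contra h
      push Not at h
      have hsub : S ⊆ S.filter (fun w ↦ 1 ≤ E w) ∪ T ∪ univ.image v := by
        intro w hw
        by_cases h1 : 1 ≤ E w
        · exact mem_union_left _ (mem_union_left _ (mem_filter.mpr ⟨hw, h1⟩))
        by_cases h2 : w ∈ T
        · exact mem_union_left _ (mem_union_right _ h2)
        exact mem_union_right _ (h w hw (not_le.mp h1) h2)
      have h3 := card_le_card hsub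
      have h4 : (S.filter (fun w ↦ 1 ≤ E w) ∪ T ∪ univ.image v).card ≤
          (S.filter (fun w ↦ 1 ≤ E w)).card + T.card + (univ.image v).card :=
        (card_union_le _ _).trans (Nat.add_le_add_right (card_union_le _ _) _)
      have h5 : (univ.image v).card ≤ r := card_image_le.trans (by simp)
      have : (S.card : ℤ) ≤ E.degree + T.card + r := by
        have h6 := h3.trans h4
        have h7 := (Nat.cast_le (α := ℤ)).mpr h6
        have h8 := (Nat.cast_le (α := ℤ)).mpr h5
        push_cast at h7 h8
        linarith [hbad, h7, h8]
      rw [hEdeg] at this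
      omega
    have hEw : E w = 0 := le_antisymm (by omega) (hE0 w)
    -- the new tuple `(w, v)`
    refine ⟨Fin.cons w v, ?_, fun i ↦ Fin.cases hwS (fun i ↦ hvS i) i, fun i ↦ Fin.cases hwT (fun i ↦ hvT i) i, ?_⟩
    · refine Fin.cons_injective_iff.mpr ⟨fun hmem ↦ hwv ?_, hvinj⟩
      obtain ⟨i, hi⟩ := hmem
      exact mem_image.mpr ⟨i, mem_univ _, hi⟩
    rw [Fin.sum_univ_succ]
    simp only [Fin.cons_zero, Fin.cons_succ]
    have hsub : W - D₀ - (Finsupp.single w 1 + ∑ i, Finsupp.single (v i) 1) = (W - D) - Finsupp.single w 1 := by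
      rw [hD]; abel
    rw [hsub]
    -- lower bound: `ℓ(W − D) ≤ ℓ(W − D − w) + 1`
    have hle : ell (W - D) ≤ ell (W - D - Finsupp.single w 1) + 1 := by
      have h := ell_add_single_le (W - D - Finsupp.single w 1) w
      rw [sub_add_cancel, hS w hwS] at h
      exact h
    -- strict drop: `f ∉ 𝓛(W − D − w)`
    have hlt : ell (W - D - Finsupp.single w 1) < ell (W - D) := by
      haveI := finiteDimensional_riemannRochSpace_of_isAlgFunctionField (K := K) (W - D)
      apply Submodule.finrank_lt_finrank_of_lt
      refine lt_of_le_of_ne (riemannRochSpace_mono ?_) fun heq ↦ ?_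
      · intro u
        simp only [Finsupp.coe_sub, Pi.sub_apply, Finsupp.single_apply]
        split_ifs <;> omega
      · have hf' : f ∈ riemannRochSpace (W - D - Finsupp.single w 1) := by rw [heq]; exact hf
        have h0 := (mem_riemannRochSpace_iff_nonneg _ hf0).1 hf' w
        simp only [Finsupp.coe_add, Finsupp.coe_sub, Pi.add_apply, Pi.sub_apply,
          Finsupp.single_eq_same, Finsupp.coe_zero, Pi.zero_apply] at h0
        have : E w = principalDivisor K f w + (W - D) w := rfl
        rw [Finsupp.coe_sub, Pi.sub_apply] at this
        omega
    omega

/-- **Milne, *Jacobian Varieties*, Lemma 5.2 (b), POINTED AND DISTINCT form**: for an algebraic function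
field `F/K` of one variable with full constant field `K` and genus `g ≥ 1`, a RATIONAL place `Q`, a finite
set `T` of places and a set `S` of rational places with `#S ≥ 2g + #T + 1`, there are PAIRWISE DISTINCT
rational places `P₁, …, P_{g−1} ∈ S`, all outside `T` and different from `Q`, with
`ℓ(Q + P₁ + ⋯ + P_{g−1}) = 1` (so the effective divisor `Q + Σ Pⱼ` of degree `g` is non-special: a point of
Weil's chart `W ⊆ C^{(g)}`, ★ `Motives/CurveSymmetricChart`).  Proof: `ℓ(W − Q) = g − 1`
(`ell_canonical_sub_single`), the induction `exists_injective_ell_canonical_sub_eq` with base `D₀ = Q`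
and avoidance set `T ∪ {Q}` down to `ℓ(W − Q − Σ Pⱼ) = 0`, then Riemann–Roch.
[cite: Milne1986JacobianVarieties, §5 Lemma 5.2 (b) and §2 Prop. 2.3 (proof)]
[cite: Stichtenoth2009, Thm. 1.5.15] -/
theorem exists_injective_ell_single_add_sum_eq_one [IsAlgFunctionField K F] [IsIntegrallyClosedIn K F]
    (hg : 1 ≤ genus K F) {Q : PlaceOver K F} (hQ : Q.degree = 1) (T S : Finset (PlaceOver K F))
    (hS : ∀ v ∈ S, v.degree = 1) (hcard : 2 * genus K F + T.card + 1 ≤ S.card) :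
    ∃ v : Fin (genus K F - 1) → PlaceOver K F, Function.Injective v ∧ (∀ i, v i ∈ S) ∧ (∀ i, v i ∉ T) ∧
      (∀ i, v i ≠ Q) ∧ ell (Finsupp.single Q 1 + ∑ i, Finsupp.single (v i) (1 : ℤ)) = 1 := by
  classical
  obtain ⟨W, hW, hRR⟩ := riemann_roch_holds (K := K) (F := F)
  have h0 : ell (W - Finsupp.single Q 1) + 1 = genus K F := ell_canonical_sub_single hRR hQ hg
  have hcard' : 2 * genus K F + (insert Q T).card ≤ S.card :=
    (Nat.add_le_add_left (card_insert_le Q T) _).trans (by omega)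
  obtain ⟨v, hvinj, hvS, hvT, hv⟩ := exists_injective_ell_canonical_sub_eq hW (Finsupp.single Q 1) 1
    (by rw [Divisor.degree_single, hQ]; simp) h0 (insert Q T) S hS hcard' (genus K F - 1) (by omega)
  refine ⟨v, hvinj, hvS, fun i h ↦ hvT i (mem_insert_of_mem h), fun i h ↦ hvT i (h ▸ mem_insert_self Q T), ?_⟩
  -- Riemann–Roch at `D = Q + Σ Pⱼ`: `ℓ(D) = g + 1 − g + ℓ(W − D) = 1`
  have hell0 : ell (W - Finsupp.single Q 1 - ∑ i, Finsupp.single (v i) 1) = 0 := by omega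
  have h := hRR (Finsupp.single Q 1 + ∑ i, Finsupp.single (v i) 1)
  have hdeg : (Finsupp.single Q 1 + ∑ i, Finsupp.single (v i) (1 : ℤ) : Divisor K F).degree = genus K F := by
    rw [map_add, Divisor.degree_single, hQ, degree_sum_single_of_degree_eq_one v fun i ↦ hS _ (hvS i)]
    push_cast
    omega
  rw [hdeg, show W - (Finsupp.single Q 1 + ∑ i, Finsupp.single (v i) 1) =
      W - Finsupp.single Q 1 - ∑ i, Finsupp.single (v i) 1 by abel, hell0] at h
  push_cast at h
  have : (ell (Finsupp.single Q 1 + ∑ i, Finsupp.single (v i) (1 : ℤ)) : ℤ) = 1 := by linarith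
  exact_mod_cast this

end Literature.NumberTheory.DiophantineGeometry.AlgFunctionField

end
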